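import Literature.NumberTheory.EllipticCurves.Tian2014.CMPointSystemDescentPrimeBase
import Literature.NumberTheory.EllipticCurves.Tian2014.CMPointSystemDescentOneFive
import HarnessLib

/-!
# Tian 2014 Thm. 4.5 at `k = 1` (= Monsky 1990 Thm. 5.9 (1) as stated in Thm. 5.14 (14): `N = 2p₁p₃` with `(p₁/p₃) = −1`)
# transplanted onto the `n ≡ 3 (mod 4)` CM-point system: the relation (4.11) at `k = 1` on a `B`-stable transversal, (4.10),
# and the descent `y_{2n} ∉ 2E(ℚ(√−2n))⁻ + E[2]` from the printed system + Tian's printed divisibility sentence for `y_{2p₀}`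

Cell `bsd-monsky` (prover-A seat, g14; `run/shared/lean/pub/bsd-monsky/`). HONEST FRAMING (README §1): nothing is asserted
about BSD, nothing is booked, no `_holds`, no named fact; this file PROVES theorems on the data `D : CMPointData n` of
`CMPointSystemDisplays.lean` (Tian's Thm. 2.8 system, the system of the cell's enclosure) with its printed properties as
hypotheses. NOTHING NEW ON PAPER: Tian proves Thm. 4.5 in print by induction on `k`; this is its FIRST STEP `k = 1`
(`n = p₀p₁`, `p₀ ≡ 3`, `p₁ ≡ 1 (mod 8)`, `m = 2n`), which is Monsky's Cor. 5.15 (3) «`2p₁p₃` when `(p₁/p₃) = −1`» (Thm. 5.14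
(14), proved there by Thm. 5.9 with the real-locus Lemma 5.6 — the route g10 found blocked on the skeleton), transplanted
onto Tian's point by TIAN'S route. The one ANALYTIC input of Tian's step — "(2) for each positive `d` with `2p₀ | d | 2n`
and `d ≠ 2n`, `y_d ∈ 2^k E(ℚ(√−d))⁻ + E[2]`" (from Thm. 3.3, p0021 L62–L70 / p0027 L1–L4) — is the BINDER `hDiv` on the
signed point `y_{2p₀,φ}`; everything else is the printed skeleton (Thm. 2.8, (4.8), the Galois facts), the §4.2 sentences
on `√p₁ ∈ H₀ ⊂ H` (fixed by `σ_{1+ϖ}`, by complex conjugation, and by `σ_{ϖ′}` — "`Ker χ` contains the class `[ϖ′]`",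
p0022 L81–L83) and on the ambiguous class `[ϖ′_{p₁}]` (`B² = 1`, `B ∉ {1, [ϖ′]}`, `χ_{2p₀}(B) = −1`), and g13's binder
"`σ_{1+ϖ}` moves `i` but fixes `√2`" for the `E[4]` check. "`2𝒜` odd" (Tian's (1.1) at `k = 1`: the graph condition
`(p₁/p₀) = −1`) and "`#𝒜[2] = 4`" are KERNEL THEOREMS (Rédei–Reichardt, Gauss).

## Source (verbatim, arXiv:1210.8231)

* Thm. 4.5 (p0023 L8–L14): "Let `k ≥ 0` be an integer and `n = p₀p₁⋯p_k` a product of distinct primes with `p₀ ≡ 3 mod 8`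
  and `p₁, ⋯, p_k ≡ 1 mod 8`. Then `y_{2n} ∈ 2^{k−1}E(ℚ(√−2n))⁻ + E[2]`, and if the field `K = ℚ(√−2n)` has no order `4`
  ideal class, then the point `y_{2n} ∉ 2^k E(ℚ(√−2n))⁻ + E[2]`."
* p0026 L82–L87: "Finally, we consider the case that `p₀ ≡ 3 mod 8` and `k ≥ 1`. Then `𝒜 = 2𝒜 × 𝒜[2]` and `[ϖ′] ∈ 𝒜[2]`.
  Let `ψ` be the set of representatives for `𝒜[2]/([ϖ′])` consisting of those `[ϖ′_d]` fixing `√2`, then `φ := ⋃_{[s]∈ψ}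
  [s](2𝒜)` is a set of representatives for `𝒜/([ϖ′])`. The set `φ` is stable under `[t] ↦ [t]⁻¹` and we use `φ` to define
  all `y_d`'s." Lemma 4.9 (p0026 L88–L98): "(1) for each positive divisor `d` of `2n` divisible by `2p₀`, the point `y_d ∈
  E(ℚ(√−d))⁻`; (2) the point `y₀ := Σ_{[t]∈2𝒜} z_t ∈ E(H₀(i))` satisfies the following relation: (4.10) `y₀^{σ_{1+ϖ}} − y₀ =
  #2𝒜·(0, 0)`. Moreover, these points satisfy the following relation: (4.11) `Σ_{2p₀|d|2n} y_d = 2^k y₀`." Proof (p0026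
  L99–L108): "Σ_{2p₀|d|2n} y_d = Σ_{[t]∈2𝒜} Σ_{[s]∈ψ} (Σ_{2p₀|d|2n} χ_d(s)) z_t^{σ_s}. It is clear that the summation in the
  last bracket is equal to `2^k` for `σ_s = 1` and `0` otherwise."
* Proof of Thm. 4.5 (p0026 L109–p0027 L20): "(1) the point `y_{2n} ∈ 2^{k−1}E(ℚ(√−2n))⁻ + E[2]`, using the equality (4.11);
  (2) for each positive `d` with `2p₀ | d | 2n` and `d ≠ 2n`, `y_d ∈ 2^k E(ℚ(√−d))⁻ + E[2]`, i.e. of form `2^k y′_d + t_d`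
  for some `y′_d ∈ E(ℚ(√−d))⁻` and `t_d ∈ E[2]`. Now we show that `y_{2n} ∉ 2^k E(ℚ(√−2n))⁻ + E[2]` if the field `K = ℚ(√−2n)`
  has no order `4` ideal class. Suppose it is not the case, i.e. `y_{2n} = 2^k y′_{2n} + t_{2n}` … Then as before, we have
  that `P := y′_{2n} − y₀ + Σ_{2p₀|d|2n, d≠2n} y′_d ∈ E[2^{k+1}] ∩ E(H₀(i)) = E[2^{k+1}] ∩ E(ℚ(i,√2)) = E[4]`. Thus we have
  the formula `y₀ = Σ y′_d − P` with `P ∈ E[4]`, and then `y₀^{σ_{1+ϖ}} − y₀ = Σ((y′_d)^{σ_{1+ϖ}} − y′_d) − (P^{σ_{1+ϖ}} − P) =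
  −P^{σ_{1+ϖ}} + P = 0` or `(−1, 0)`. But if `𝒜` has no order `4` element or equivalently `2𝒜` is odd, we have
  `y₀^{σ_{1+ϖ}} − y₀ = (0, 0)` by the equality (4.10) in Lemma 4.9. It is a contradiction."
* §4.2 (p0022 L77–L83): "Let `χ = χ_d` be the character of `𝒜 = Gal(H(i)/K(i))` factoring through `Gal(K(i,√−d)/K(i))` which
  is non-trivial when `d ≠ 2n`. Since `Ker χ` contains the class `[ϖ′] ∈ 𝒜` of `ϖ′`, the character `χ` factors through
  `𝒜/⟨[ϖ′]⟩`."

## What is proved here (kernel), and from what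

* §1 On a `B`-stable transversal `φ` of `𝒜/[ϖ′]` (`B` the ambiguous class `[ϖ′_{p₁}]`; such `φ` exist — the tree's
  `exists_isReps_isStableUnder`, Monsky Thm. 4.7's `φ = φ₀ ∪ Bφ₀`), with `θ₀′ := √−2n/√p₁ = √−2p₀`: the half
  `φ⁺ = {t ∈ φ : σ_t θ₀′ = θ₀′}` and its complement `Bφ⁺`; `#φ⁺ = #(2𝒜)` is odd; **(4.11) at `k = 1`**:
  `y_{2p₀,φ} + y_{2n,φ} = 2y₀` with `y₀ := Σ_{t∈φ⁺} z_t` (Tian's `y₀ = Σ_{2𝒜} z_t` for `φ = 2𝒜 ∪ B·2𝒜`); **(4.10)**: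
  `σ_{1+ϖ}(y₀) − y₀ = #φ⁺·(0,0) = (0,0)`.
* §2 `K = ℚ(√−2p₀p₁)`: `#𝒜[2] = 4` (Gauss), `#(2𝒜)` odd (`odd_genusClassNumber_two_mul_caseThree` at `k = 1` with the graph
  condition from `(p₁/p₀) = −1`).
* §3 THE DESCENT: `y_{2n,φ} = transfer y″` (the tree's `exists_transfer_eq_yPoint`, Lemma 4.9 (1) / Monsky Thm. 4.7); if
  `y″ = 2z + t` then with `hDiv : y_{2p₀,φ} = 2S′ + T′`, (4.11) gives `P := y₀ − S − S′ ∈ E[4]`, `σ_{1+ϖ}` fixes `S` and `S′`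
  (transfer images along `√−2n`, `√−2p₀`, both fixed by `σ_{1+ϖ}`), so `σ_{1+ϖ}(P) − P = σ_{1+ϖ}(y₀) − y₀ = (0,0)` — against
  the `E[4]` check (`map_sub_ne_ptZero_of_two_nsmul_two_nsmul_eq_zero`). At `k = 1` Tian's `E[2^{k+1}] ∩ E(H₀(i)) = E[4]`
  is the tautology `E[4] = E[4]`: no ramification sentence is needed.

[cite: Tian2014, Thm. 4.5 (arXiv:1210.8231 p0023 L8–L14), §4.2 (p0022 L47–L96), Lemma 4.9 and its proof (p0026 L82–L108), proof of Thm. 4.5 (p0026 L109–p0027 L20), Thm. 3.3 (p0014 L99–L105), Lemma 5.1 (p. 28)]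
[cite: Monsky1990MockHeegner, Thm. 4.7 (pp. 57–58), Thm. 5.9 (1) (pp. 63–64), Thm. 5.14 (14) and Cor. 5.15 (3) (p. 66)] [cite: Cox2013, Prop. 3.11] [cite: LiMa2008, Thm. 0.4]
-/

noncomputable section

open scoped Classical

open Matrix WeierstrassCurve NumberField Literature.NumberTheory.EllipticCurves
  Literature.NumberTheory.EllipticCurves.TianYuanZhang2017
  Literature.NumberTheory.EllipticCurves.HeathBrown1994
  Literature.NumberTheory.QuadraticFields.RedeiReichardt
  Literature.GroupTheory.FiniteAbelian

set_option autoImplicit false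

namespace Literature.NumberTheory.EllipticCurves.Tian2014

/-! ## §0 `K = ℚ(√−2p₀p₁)`, `p₀ ≡ 3`, `p₁ ≡ 1 (mod 8)`, `(p₁/p₀) = −1`: `#𝒜[2] = 4` and `#(2𝒜)` odd -/

section ClassGroupThreeOne

/-- **The class-group inputs of Tian's Thm. 4.5 at `k = 1`, for `K = ℚ(√−2p₀p₁)`, `p₀ ≡ 3`, `p₁ ≡ 1 (mod 8)`, `(p₁/p₀) = −1`**:
`#(2𝒜)` is ODD (Tian's condition (1.1): "if `p₀ ≡ 3 mod 8`, then `𝒜` has no order `4` elements, or equivalently, `2𝒜` has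
odd cardinality", p0022 L67–L68 — the tree's `odd_genusClassNumber_two_mul_caseThree` with the graph condition at `k = 1`:
`(p₁/p₀) = −1` gives `(p₀/p₁) = −1` by quadratic reciprocity, so Monsky's matrix is `A = (1 1; 1 1)` with kernel `{0, (1,1)}`;
Rédei–Reichardt a tree theorem) and `#𝒜 = 4·#(2𝒜)` (Gauss: `#𝒜[2] = 2^{t−1} = 4`, `t = 3` ramified primes `2, p₀, p₁`;
`#𝒜 = #(2𝒜)·#𝒜[2]`). One statement (the `p₀ ≡ 5 (mod 8)` twins are `CMPointDataOne.*_two_primes` of the sibling file).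
[cite: Tian2014, §4.2 (p0022 L64–L68), Lemma 5.1 (p. 28)] [cite: LiMa2008, Thm. 0.4] [cite: Cox2013, Prop. 3.11]
[cite: HeathBrown1994SelmerCongruentII, Appendix (Monsky), typescript p. 39 L13–L26] -/
theorem classGroup_three_one {p₀ p₁ : ℕ} (hp₀ : p₀.Prime) (hp₁ : p₁.Prime) (h₀3 : p₀ % 8 = 3) (h₁1 : p₁ % 8 = 1)
    (hj : jacobiSym (p₁ : ℤ) p₀ = -1) :
    Odd (Nat.card {a : ClassGroup (𝓞 (GenusField (2 * (p₀ * p₁)))) // IsSquare a}) ∧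
    Nat.card (ClassGroup (𝓞 (GenusField (2 * (p₀ * p₁))))) =
      4 * Nat.card {a : ClassGroup (𝓞 (GenusField (2 * (p₀ * p₁)))) // IsSquare a} := by
  have hne : p₀ ≠ p₁ := by omega
  have hp₀2 : p₀ ≠ 2 := by omega
  have hp₁2 : p₁ ≠ 2 := by omega
  have hd1 : 1 ≤ 2 * (p₀ * p₁) := by have := hp₀.two_le; have := hp₁.two_le; nlinarith
  -- Gauss: `#𝒜[2] = 4`
  have hgauss : Nat.card {c : ClassGroup (𝓞 (GenusField (2 * (p₀ * p₁)))) // c ^ 2 = 1} = 4 := by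
    obtain ⟨x, -, hx⟩ := exists_ringOfIntegers_sq_eq_neg (K := GenusField (2 * (p₀ * p₁))) (root_genusField_sq hd1)
    have hq : ∀ i, ((![2, p₀, p₁] : Fin 3 → ℕ) i).Prime := by
      intro i; fin_cases i
      · exact Nat.prime_two
      · exact hp₀
      · exact hp₁
    have hinj : Function.Injective (![2, p₀, p₁] : Fin 3 → ℕ) := by
      intro i j hij
      fin_cases i <;> fin_cases j <;> simp_all
    have hprod : ∏ i, (![2, p₀, p₁] : Fin 3 → ℕ) i =
        if (2 * (p₀ * p₁)) % 4 = 1 then 2 * (2 * (p₀ * p₁)) else 2 * (p₀ * p₁) := by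
      rw [if_neg (by omega), Fin.prod_univ_three]
      simp [mul_assoc]
    have := natCard_sq_eq_one_eq (finrank_genusField (2 * (p₀ * p₁))) hx hq hinj hprod
    simpa using this
  -- the graph condition at `k = 1`
  have hG : ∀ v : Fin 2 → ZMod 2, legendreMatrix ![p₀, p₁] *ᵥ v = 0 → v = 0 ∨ v = fun _ => 1 := by
    have hj' : jacobiSym (p₀ : ℤ) p₁ = -1 := by
      have h := jacobiSym.quadratic_reciprocity_one_mod_four (a := p₁) (b := p₀) (by omega)
        (Nat.odd_iff.mpr (by omega))
      rw [← h]; exact hj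
    have ha10 : addLegendreSym (p₁ : ℤ) p₀ = 1 := addLegendreSym_of_eq_neg_one hj
    have ha01 : addLegendreSym (p₀ : ℤ) p₁ = 1 := addLegendreSym_of_eq_neg_one hj'
    have hM : ∀ i j : Fin 2, legendreMatrix ![p₀, p₁] i j = 1 := by
      intro i j
      fin_cases i <;> fin_cases j <;>
        simp [legendreMatrix, Finset.sum_erase_eq_sub, Fin.sum_univ_two, ha10, ha01]
    intro v hv
    have h0 := congr_fun hv 0
    simp only [Matrix.mulVec, dotProduct, Fin.sum_univ_two, hM, one_mul, Pi.zero_apply] at h0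
    have hv01 : v 1 = v 0 := by
      have h2 : ∀ a b : ZMod 2, a + b = 0 → b = a := by decide
      exact h2 _ _ h0
    rcases (by decide : ∀ a : ZMod 2, a = 0 ∨ a = 1) (v 0) with h | h
    · left; funext i; revert i; rw [Fin.forall_fin_two]
      exact ⟨h, by rw [hv01]; exact h⟩
    · right; funext i; revert i; rw [Fin.forall_fin_two]
      exact ⟨h, by rw [hv01]; exact h⟩
  -- Tian's (1.1) at `k = 1`: `#(2𝒜)` odd
  have hodd : Odd (Nat.card {a : ClassGroup (𝓞 (GenusField (2 * (p₀ * p₁)))) // IsSquare a}) := by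
    have hq : ∀ i, ((![p₀, p₁] : Fin 2 → ℕ) i).Prime := by
      intro i; fin_cases i
      · exact hp₀
      · exact hp₁
    have hinj : Function.Injective (![p₀, p₁] : Fin 2 → ℕ) := by
      intro i j hij
      fin_cases i <;> fin_cases j <;> simp_all
    have h30 : (![p₀, p₁] : Fin 2 → ℕ) 0 % 8 = 3 := h₀3
    have h1 : ∀ i : Fin 2, i ≠ 0 → (![p₀, p₁] : Fin 2 → ℕ) i % 8 = 1 := by
      intro i hi; fin_cases i
      · exact absurd rfl hi
      · exact h₁1
    have hn : ∏ i, (![p₀, p₁] : Fin 2 → ℕ) i = p₀ * p₁ := by simp [Fin.prod_univ_two]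
    exact odd_genusClassNumber_two_mul_caseThree ![p₀, p₁] redeiReichardt_fourTwoCard_classGroup_holds hq hinj h30 h1
      hG hn (GenusField (2 * (p₀ * p₁))) (isQuadraticFieldOfSqrt_genusField hd1)
  refine ⟨hodd, ?_⟩
  rw [natCard_eq_card_isSquare_mul_card_sq_eq_one (ClassGroup (𝓞 (GenusField (2 * (p₀ * p₁))))), hgauss, mul_comm]

end ClassGroupThreeOne

namespace CMPointData

variable {n : ℕ}

/-! ## §1 The relation (4.11) at `k = 1` on a `B`-stable transversal, and (4.10) -/

section RelationFourEleven

variable (D : CMPointData n) {θ₁ : D.H} {B : ClassGroup (𝓞 (GenusField (2 * n)))}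

/-- `σ_s(√−2n/√p₁) = ±(√−2n/√p₁)` according as `σ_s` fixes or moves `√p₁` (`σ_s` fixes `√−2n`).
[cite: Tian2014, §4.2 (p0022 L77–L83)] [folklore] -/
theorem art_div_eq (hart : ∀ s, D.art s D.sqrtNegTwoN = D.sqrtNegTwoN) (s : ClassGroup (𝓞 (GenusField (2 * n)))) :
    D.art s (D.sqrtNegTwoN / θ₁) = D.sqrtNegTwoN / D.art s θ₁ := by
  rw [map_div₀, hart s]

/-- **The two halves of a `B`-stable transversal**: if `σ_B` moves `√p₁`, then `t ↦ Bt` maps `φ⁺ = {t ∈ φ : σ_t√p₁ = √p₁}`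
onto `φ⁻ = {t ∈ φ : σ_t√p₁ ≠ √p₁}`. [cite: Tian2014, Lemma 4.9 proof (p0026 L99–L108)] [cite: Monsky1990MockHeegner, Thm. 4.7 proof (pp. 57–58)] -/
theorem filter_not_eq_image_filter (hB2 : B * B = 1) (hBθ₁ : D.art B θ₁ = -θ₁) {N : ℕ} (hN : N ≠ 0)
    (hθ₁ : θ₁ ^ 2 = (N : D.H)) {φ : Finset (ClassGroup (𝓞 (GenusField (2 * n))))} (hs : IsStableUnder B φ) :
    φ.filter (fun t => ¬ D.art t θ₁ = θ₁) = (φ.filter fun t => D.art t θ₁ = θ₁).image (fun t => B * t) := by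
  have hne : θ₁ ≠ -θ₁ := by
    intro h
    apply ne_zero_of_sq_eq_natCast' hN hθ₁
    have : (2 : D.H) * θ₁ = 0 := by linear_combination h
    rcases mul_eq_zero.mp this with h2 | h2
    · exact absurd h2 two_ne_zero
    · exact h2
  have hpm : ∀ t, D.art t θ₁ = θ₁ ∨ D.art t θ₁ = -θ₁ := fun t =>
    gal_sqrt_pos_eq_or_eq_neg N θ₁ (sq_eq_algebraMap_of_sq_eq_natCast' hθ₁) (D.art t)
  ext x
  simp only [Finset.mem_filter, Finset.mem_image]
  constructor
  · rintro ⟨hx, hxn⟩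
    refine ⟨B * x, ⟨hs x hx, ?_⟩, by rw [← mul_assoc, hB2, one_mul]⟩
    rw [map_mul, AlgEquiv.mul_apply, (hpm x).resolve_left hxn, map_neg, hBθ₁, neg_neg]
  · rintro ⟨t, ⟨ht, hte⟩, rfl⟩
    refine ⟨hs t ht, ?_⟩
    rw [map_mul, AlgEquiv.mul_apply, hte, hBθ₁]
    exact fun h => hne h.symm

/-- **`#φ⁺ = #(2𝒜)`** for a `B`-stable transversal `φ` (`#φ = #𝒜/2`, the halves are swapped by `B`, `#𝒜 = 4·#(2𝒜)`).
[cite: Tian2014, Lemma 4.9 proof (p0026 L99–L108)] [cite: Cox2013, Prop. 3.11] -/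
theorem card_filter_eq_of_isStableUnder (hπ2 : D.piPrime * D.piPrime = 1) (hB2 : B * B = 1)
    (hBθ₁ : D.art B θ₁ = -θ₁) {N : ℕ} (hN : N ≠ 0) (hθ₁ : θ₁ ^ 2 = (N : D.H))
    (hcard4 : Nat.card (ClassGroup (𝓞 (GenusField (2 * n)))) =
      4 * Nat.card {a : ClassGroup (𝓞 (GenusField (2 * n))) // IsSquare a})
    {φ : Finset (ClassGroup (𝓞 (GenusField (2 * n))))} (hφ : D.IsRepsModPiPrime φ) (hs : IsStableUnder B φ) :
    (φ.filter fun t => D.art t θ₁ = θ₁).card = Nat.card {a : ClassGroup (𝓞 (GenusField (2 * n))) // IsSquare a} := by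
  have h2 := natCard_eq_two_mul_card_of_isReps hπ2 hφ
  have hsplit := Finset.card_filter_add_card_filter_not (s := φ) (fun t => D.art t θ₁ = θ₁)
  rw [D.filter_not_eq_image_filter hB2 hBθ₁ hN hθ₁ hs,
    Finset.card_image_of_injOn (fun a _ b _ hab => mul_left_cancel hab)] at hsplit
  omega

/-- **(4.11) at `k = 1`: `y_{2p₀,φ} + y_{2n,φ} = 2·y₀`** on ANY transversal `φ`, with `y₀ := Σ_{t∈φ⁺} z_t`, `φ⁺ = {t ∈ φ :
σ_t√p₁ = √p₁}` (`θ₀′ = √−2n/√p₁`; `χ_{2p₀}(t) = +1` on `φ⁺`, `−1` off it). [cite: Tian2014, Lemma 4.9 (4.11) and its proof (p0026 L96–L108)] -/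
theorem yPointChi_add_yPoint_eq (hn0 : n ≠ 0) (hart : ∀ s, D.art s D.sqrtNegTwoN = D.sqrtNegTwoN) {N : ℕ}
    (hN : N ≠ 0) (hθ₁ : θ₁ ^ 2 = (N : D.H)) (φ : Finset (ClassGroup (𝓞 (GenusField (2 * n))))) :
    D.yPointChi (D.sqrtNegTwoN / θ₁) φ + D.yPoint φ =
      (2 : ℕ) • ∑ t ∈ φ.filter (fun t => D.art t θ₁ = θ₁), D.z t := by
  have hθ₁0 : θ₁ ≠ 0 := ne_zero_of_sq_eq_natCast' hN hθ₁
  have hθ₀'0 : D.sqrtNegTwoN / θ₁ ≠ 0 := div_ne_zero (D.sqrtNegTwoN_ne_zero hn0) hθ₁0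
  have hneg : -(D.sqrtNegTwoN / θ₁) ≠ D.sqrtNegTwoN / θ₁ := by
    intro h
    apply hθ₀'0
    have h2 : (2 : D.H) * (D.sqrtNegTwoN / θ₁) = 0 := by linear_combination -h
    rcases mul_eq_zero.mp h2 with h3 | h3
    · exact absurd h3 two_ne_zero
    · exact h3
  have hpm : ∀ t, D.art t θ₁ = θ₁ ∨ D.art t θ₁ = -θ₁ := fun t =>
    gal_sqrt_pos_eq_or_eq_neg N θ₁ (sq_eq_algebraMap_of_sq_eq_natCast' hθ₁) (D.art t)
  have hchi : ∀ t, D.chi (D.sqrtNegTwoN / θ₁) t = if D.art t θ₁ = θ₁ then 1 else -1 := by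
    intro t
    unfold chi
    rw [D.art_div_eq hart t]
    by_cases h : D.art t θ₁ = θ₁
    · rw [if_pos h, if_pos (by rw [h])]
    · rw [if_neg h, if_neg]
      rw [(hpm t).resolve_left h, div_neg]
      exact hneg
  unfold yPointChi yPoint
  rw [← Finset.sum_add_distrib, ← Finset.sum_filter_add_sum_filter_not φ (fun t => D.art t θ₁ = θ₁),
    Finset.smul_sum]
  have h1 : ∑ t ∈ φ.filter (fun t => D.art t θ₁ = θ₁), (D.chi (D.sqrtNegTwoN / θ₁) t • D.z t + D.z t) =
      ∑ t ∈ φ.filter (fun t => D.art t θ₁ = θ₁), (2 : ℕ) • D.z t := by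
    refine Finset.sum_congr rfl (fun t ht => ?_)
    rw [hchi, if_pos (Finset.mem_filter.mp ht).2, one_zsmul, two_nsmul]
  have h2 : ∑ t ∈ φ.filter (fun t => ¬ D.art t θ₁ = θ₁), (D.chi (D.sqrtNegTwoN / θ₁) t • D.z t + D.z t) = 0 := by
    refine Finset.sum_eq_zero (fun t ht => ?_)
    rw [hchi, if_neg (Finset.mem_filter.mp ht).2, neg_one_zsmul, neg_add_cancel]
  rw [h1, h2, add_zero]

/-- **(4.10): `σ_{1+ϖ}(y₀) − y₀ = #φ⁺·(0, 0) = (0, 0)`** when `#φ⁺` is odd (Thm. 2.8 (1) summand by summand).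
[cite: Tian2014, Lemma 4.9 (4.10) and its proof (p0026 L93–L95, L99–L101)] -/
theorem act_tau_sum_filter (h1 : D.thm28_1) {φ : Finset (ClassGroup (𝓞 (GenusField (2 * n))))}
    (hodd : Odd (φ.filter fun t => D.art t θ₁ = θ₁).card) :
    D.act D.tau (∑ t ∈ φ.filter (fun t => D.art t θ₁ = θ₁), D.z t) =
      ∑ t ∈ φ.filter (fun t => D.art t θ₁ = θ₁), D.z t + ptZero := by
  rw [map_sum, Finset.sum_congr rfl (fun t _ => h1 t), Finset.sum_add_distrib, Finset.sum_const,
    odd_nsmul_of_two_nsmul_eq_zero two_nsmul_ptZero hodd]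

end RelationFourEleven

/-! ## §2 Tian Thm. 4.5 at `k = 1` on the data: `y_{2n} ∉ 2E(ℚ(√−2n))⁻ + E[2]` -/

section DescentThreeOne

variable (D : CMPointData n) {θ₁ : D.H} {B : ClassGroup (𝓞 (GenusField (2 * n)))} {p₀ p₁ : ℕ}

/-- `θ₀′ = √−2n/√p₁` squares to `−2p₀` when `n = p₀p₁` (plumbing for the transfer to `E_{2p₀}`).
[cite: Tian2014, §4.2 (p0022 L77–L83: √−d ∈ H₀ for 2p₀ | d | 2n)] [folklore] -/
theorem div_sq_eq_neg (hn : n = p₀ * p₁) (hp₁ : p₁ ≠ 0) (hθ₁ : θ₁ ^ 2 = (p₁ : D.H)) :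
    (D.sqrtNegTwoN / θ₁) ^ 2 = algebraMap ℚ D.H (-((2 * p₀ : ℕ) : ℚ)) := by
  have hθ₁0 : θ₁ ≠ 0 := ne_zero_of_sq_eq_natCast' hp₁ hθ₁
  have hcast : ((2 * n : ℕ) : D.H) = ((2 * (p₀ * p₁) : ℕ) : D.H) :=
    congrArg (fun m : ℕ => ((2 * m : ℕ) : D.H)) hn
  rw [div_pow, hθ₁, D.sqrtNegTwoN_sq, map_neg, map_natCast, hcast]
  have hp₁' : (p₁ : D.H) ≠ 0 := Nat.cast_ne_zero.mpr hp₁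
  push_cast
  field_simp

/-- `θ₀′ = √−2n/√p₁ ≠ 0`. [cite: Tian2014, §4.2 (p0022 L77–L83)] [folklore] -/
theorem div_ne_zero' (hn0 : n ≠ 0) (hp₁ : p₁ ≠ 0) (hθ₁ : θ₁ ^ 2 = (p₁ : D.H)) : D.sqrtNegTwoN / θ₁ ≠ 0 :=
  div_ne_zero (D.sqrtNegTwoN_ne_zero hn0) (ne_zero_of_sq_eq_natCast' hp₁ hθ₁)

/-- **Tian Thm. 4.5 at `k = 1` (= Monsky Thm. 5.14 (14), `2p₁p₃` with `(p₁/p₃) = −1`), the descent step on the data**: for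
`n = p₀p₁` square-free with `2n` square-free, a system `D` with the printed properties, g13's binder "`σ_{1+ϖ}` fixes `√2`",
a square root `θ₁ = √p₁ ∈ H` fixed by `σ_{1+ϖ}` (`√p₁ ∈ H₀ ⊂ H`; the sentences "complex conjugation fixes `√p₁`" and
"`σ_{[ϖ′]}` fixes `√p₁`" are NOT needed — the rationality of `y_{2n,φ}` is Monsky Thm. 4.7's, that of `y_{2p₀,φ}` is inside
`hDiv`), an ambiguous class `B = [ϖ′_{p₁}]` (`B² = 1`, `B ∉ {1, [ϖ′]}`) with `σ_B√p₁ = −√p₁` (`χ_{2p₀}(B) = −1`),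
the kernel inputs `#𝒜 = 4·#(2𝒜)`, `#(2𝒜)` odd, and Tian's printed divisibility sentence for the signed point
`hDiv : y_{2p₀,φ} ∈ 2E(ℚ(√−2p₀))⁻ + E[2]` on `B`-stable transversals (the consequence of Thm. 3.3 — the ONE analytic
input): there is a `B`-stable transversal `φ`, and for it `y_{2n,φ}` is the transfer of a rational `y″ ∈ E_{2n}(ℚ)`
(Lemma 4.9 (1) / Monsky Thm. 4.7) with `y″ ∉ 2E_{2n}(ℚ) + E_{2n}(ℚ)_tor`. Proof as printed: if `y_{2n,φ} = 2S + T`, (4.11)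
gives `2(y₀ − S − S′) = T + T′` so `P := y₀ − S − S′ ∈ E[4]`; `σ_{1+ϖ}` fixes `S`, `S′` (transfer images along `√−2n`, `√−2p₀`)
so `σ_{1+ϖ}(P) − P = σ_{1+ϖ}(y₀) − y₀ = (0, 0)` by (4.10) — impossible on `E[4]` (`σ_{1+ϖ}` moves `i`, fixes `√2`).
[cite: Tian2014, Thm. 4.5 (p0023 L8–L14), Lemma 4.9 (p0026 L88–L108), proof of Thm. 4.5 (p0026 L109–p0027 L20)]
[cite: Monsky1990MockHeegner, Thm. 4.7 (pp. 57–58), Thm. 5.14 (14) (p. 66)] -/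
theorem exists_isReps_isStableUnder_transfer_eq_yPoint_not_two_smul_add_torsion (hn : n = p₀ * p₁)
    (hn0 : n ≠ 0) (hp₁ : p₁ ≠ 0) (hsq2n : Squarefree (2 * n)) (hP : D.Printed)
    (hτ2 : ∀ s : D.H, s ^ 2 = 2 → D.tau s = s)
    (hθ₁ : θ₁ ^ 2 = (p₁ : D.H)) (hτθ₁ : D.tau θ₁ = θ₁)
    (hB2 : B * B = 1) (hB1 : B ≠ 1) (hBπ : B ≠ D.piPrime) (hBθ₁ : D.art B θ₁ = -θ₁)
    (hcard4 : Nat.card (ClassGroup (𝓞 (GenusField (2 * n)))) =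
      4 * Nat.card {a : ClassGroup (𝓞 (GenusField (2 * n))) // IsSquare a})
    (hodd : Odd (Nat.card {a : ClassGroup (𝓞 (GenusField (2 * n))) // IsSquare a}))
    (hDiv : ∀ φ : Finset (ClassGroup (𝓞 (GenusField (2 * n)))), D.IsRepsModPiPrime φ → IsStableUnder B φ →
      ∃ (w : (congruentNumberCurve (2 * p₀)).toAffine.Point) (T' : EPoint D.H), (2 : ℕ) • T' = 0 ∧
        D.yPointChi (D.sqrtNegTwoN / θ₁) φ =
          transferE (2 * p₀) (D.sqrtNegTwoN / θ₁) (D.div_sq_eq_neg hn hp₁ hθ₁)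
            (D.div_ne_zero' hn0 hp₁ hθ₁) ((2 : ℕ) • w) + T') :
    ∃ φ : Finset (ClassGroup (𝓞 (GenusField (2 * n)))), D.IsRepsModPiPrime φ ∧ IsStableUnder B φ ∧
      ∃ y' : (congruentNumberCurve (2 * n)).toAffine.Point, D.transfer hn0 y' = D.yPoint φ ∧
        ∀ z t : (congruentNumberCurve (2 * n)).toAffine.Point, IsOfFinAddOrder t → y' ≠ (2 : ℤ) • z + t := by
  have hP' := hP
  obtain ⟨h1, -, -, -, hart, ⟨htaui, htauθ, -⟩, -, -, -, hπ2, hπ1⟩ := hP'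
  have hart' : ∀ s, D.art s D.sqrtNegTwoN = D.sqrtNegTwoN := fun s => (hart s).2
  obtain ⟨φ, hφ, hs⟩ := exists_isReps_isStableUnder D.piPrime B hπ2 hπ1 hB2 hB1 hBπ
  have hφ' : D.IsRepsModPiPrime φ := hφ
  obtain ⟨y', hy'⟩ := D.exists_transfer_eq_yPoint hn0 hP hB2 hB1 hBπ hφ'
  refine ⟨φ, hφ', hs, y', hy', ?_⟩
  intro z t ht heq
  obtain ⟨w, T', hT'2, hyP0⟩ := hDiv φ hφ' hs
  have ht2 : (2 : ℕ) • t = 0 := two_nsmul_eq_zero_of_isOfFinAddOrder_congruentNumberCurve hsq2n ht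
  set S : EPoint D.H := D.transfer hn0 z with hS
  set T : EPoint D.H := D.transfer hn0 t with hT
  set S' : EPoint D.H := transferE (2 * p₀) (D.sqrtNegTwoN / θ₁) (D.div_sq_eq_neg hn hp₁ hθ₁)
    (D.div_ne_zero' hn0 hp₁ hθ₁) w with hS'
  have hyn : D.yPoint φ = (2 : ℕ) • S + T := by
    rw [← hy', heq, map_add, map_zsmul, two_zsmul, two_nsmul]
  have hyP0' : D.yPointChi (D.sqrtNegTwoN / θ₁) φ = (2 : ℕ) • S' + T' := by rw [hyP0, map_nsmul]
  have hT2 : (2 : ℕ) • T = 0 := by rw [hT, ← map_nsmul, ht2, map_zero]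
  -- (4.11) at `k = 1`
  have h411 := D.yPointChi_add_yPoint_eq hn0 hart' hp₁ hθ₁ φ
  rw [hyP0', hyn] at h411
  set y₀ : EPoint D.H := ∑ t ∈ φ.filter (fun t => D.art t θ₁ = θ₁), D.z t with hy₀
  set Q : EPoint D.H := y₀ - S - S' with hQdef
  have h2Q : (2 : ℕ) • Q = T' + T := by
    rw [hQdef, smul_sub, smul_sub]
    have : (2 : ℕ) • y₀ = (2 : ℕ) • S' + T' + ((2 : ℕ) • S + T) := h411.symm
    rw [this]; abel
  have h4Q : (2 : ℕ) • ((2 : ℕ) • Q) = 0 := by rw [h2Q, smul_add, hT'2, hT2, add_zero]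
  -- `#φ⁺` is odd, so (4.10): `σ_{1+ϖ}(y₀) = y₀ + (0,0)`
  have hoddφ : Odd (φ.filter fun t => D.art t θ₁ = θ₁).card := by
    rw [D.card_filter_eq_of_isStableUnder hπ2 hB2 hBθ₁ hp₁ hθ₁ hcard4 hφ' hs]; exact hodd
  have hτy₀ : D.act D.tau y₀ = y₀ + ptZero := D.act_tau_sum_filter h1 hoddφ
  -- `σ_{1+ϖ}` fixes the transfer images
  have hτS : D.act D.tau S = S := by
    rw [hS]; exact act_transferE_of_fix (2 * n) _ _ _ _ htauθ z
  have hτθ₀' : D.tau (D.sqrtNegTwoN / θ₁) = D.sqrtNegTwoN / θ₁ := by rw [map_div₀, htauθ, hτθ₁]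
  have hτS' : D.act D.tau S' = S' := by
    rw [hS']; exact act_transferE_of_fix (2 * p₀) _ _ _ _ hτθ₀' w
  have hτQ : D.act D.tau Q - Q = ptZero := by
    rw [hQdef, map_sub, map_sub, hτy₀, hτS, hτS']; abel
  exact map_sub_ne_ptZero_of_two_nsmul_two_nsmul_eq_zero D.tau D.im D.im_sq htaui hτ2 Q h4Q hτQ

/-- **Tian Thm. 4.5 at `k = 1` for `n = p₀p₁`, `p₀ ≡ 3`, `p₁ ≡ 1 (mod 8)` primes with `(p₁/p₀) = −1`** (Monsky's Cor. 5.15 (3)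
«`2p₁p₃` when `(p₁/p₃) = −1`», Thm. 5.14 (14)): the kernel inputs `#𝒜[2] = 4` and `#(2𝒜)` odd discharged (Gauss; Rédei–Reichardt
with the graph condition at `k = 1`). [cite: Tian2014, Thm. 4.5 (p0023 L8–L14), Lemma 5.1 (p. 28)] [cite: Monsky1990MockHeegner, Thm. 5.14 (14), Cor. 5.15 (3) (p. 66)] -/
theorem exists_isReps_isStableUnder_transfer_eq_yPoint_not_two_smul_add_torsion_three_one (hn : n = p₀ * p₁)
    (hp₀ : p₀.Prime) (hp₁ : p₁.Prime) (h₀3 : p₀ % 8 = 3) (h₁1 : p₁ % 8 = 1) (hj : jacobiSym (p₁ : ℤ) p₀ = -1)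
    (hP : D.Printed) (hτ2 : ∀ s : D.H, s ^ 2 = 2 → D.tau s = s)
    (hθ₁ : θ₁ ^ 2 = (p₁ : D.H)) (hτθ₁ : D.tau θ₁ = θ₁)
    (hB2 : B * B = 1) (hB1 : B ≠ 1) (hBπ : B ≠ D.piPrime) (hBθ₁ : D.art B θ₁ = -θ₁)
    (hDiv : ∀ φ : Finset (ClassGroup (𝓞 (GenusField (2 * n)))), D.IsRepsModPiPrime φ → IsStableUnder B φ →
      ∃ (w : (congruentNumberCurve (2 * p₀)).toAffine.Point) (T' : EPoint D.H), (2 : ℕ) • T' = 0 ∧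
        D.yPointChi (D.sqrtNegTwoN / θ₁) φ =
          transferE (2 * p₀) (D.sqrtNegTwoN / θ₁) (D.div_sq_eq_neg hn hp₁.ne_zero hθ₁)
            (D.div_ne_zero' (by rw [hn]; exact Nat.mul_ne_zero hp₀.ne_zero hp₁.ne_zero) hp₁.ne_zero hθ₁)
            ((2 : ℕ) • w) + T') :
    ∃ φ : Finset (ClassGroup (𝓞 (GenusField (2 * n)))), D.IsRepsModPiPrime φ ∧ IsStableUnder B φ ∧
      ∃ y' : (congruentNumberCurve (2 * n)).toAffine.Point,
        D.transfer (by rw [hn]; exact Nat.mul_ne_zero hp₀.ne_zero hp₁.ne_zero) y' = D.yPoint φ ∧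
        ∀ z t : (congruentNumberCurve (2 * n)).toAffine.Point, IsOfFinAddOrder t → y' ≠ (2 : ℤ) • z + t := by
  have hn0 : n ≠ 0 := by rw [hn]; exact Nat.mul_ne_zero hp₀.ne_zero hp₁.ne_zero
  have hsq2n : Squarefree (2 * n) := by
    rw [hn]
    have hcop : Nat.Coprime 2 (p₀ * p₁) :=
      Nat.Coprime.mul_right ((Nat.coprime_primes Nat.prime_two hp₀).mpr (by omega))
        ((Nat.coprime_primes Nat.prime_two hp₁).mpr (by omega))
    exact (Nat.squarefree_mul hcop).mpr ⟨Nat.prime_two.prime.squarefree,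
      (Nat.squarefree_mul ((Nat.coprime_primes hp₀ hp₁).mpr (by omega))).mpr
        ⟨hp₀.prime.squarefree, hp₁.prime.squarefree⟩⟩
  have hcard4 : Nat.card (ClassGroup (𝓞 (GenusField (2 * n)))) =
      4 * Nat.card {a : ClassGroup (𝓞 (GenusField (2 * n))) // IsSquare a} := by
    subst hn; exact (classGroup_three_one hp₀ hp₁ h₀3 h₁1 hj).2
  have hodd : Odd (Nat.card {a : ClassGroup (𝓞 (GenusField (2 * n))) // IsSquare a}) := by
    subst hn; exact (classGroup_three_one hp₀ hp₁ h₀3 h₁1 hj).1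
  exact D.exists_isReps_isStableUnder_transfer_eq_yPoint_not_two_smul_add_torsion hn hn0 hp₁.ne_zero hsq2n hP hτ2
    hθ₁ hτθ₁ hB2 hB1 hBπ hBθ₁ hcard4 hodd hDiv

end DescentThreeOne

end CMPointData

end Literature.NumberTheory.EllipticCurves.Tian2014

end
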